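import Summits.BirchSwinnertonDyer.BirchSwinnertonDyer.Theorems.ResidualThetaTransportAtTwoThetaTransportIntegralSchurAtTwo
import HarnessLib

/-!
# Θ-independence of the transported plus-Selmer set at `2` (crux (R≥)ᵖ `ResidualThetaCountLowerPureAtTwo`, line «bt26-lambda»,
# stubs `stub_transport` / S2 `stub_cmLambdaLower`)

Route `ResidualThetaTransportAtTwo` (RTT), crux (R≥)ᵖ `ResidualThetaCountLowerPureAtTwo` (stmt-BirchSwinnertonDyer-26074),
line «bt26-lambda»; seat `prover-bsd-rtt-w3` g0 (width helper, `--supports`, closes nothing). HONEST FRAMING: THEOREMS ONLY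
(no definition, no named fact, no instance, no `sorry`); CONDITIONAL on the route's print binder
`SerreSupersingularDecompositionImageInput` (Serre 1972 Prop. 12, item stmt-BirchSwinnertonDyer-27793), hypothesis `hSe`, exactly
like `…IntegralSchurAtTwo`; BSD is not proved by any of this.

WHAT. The `g`-side counted set of the crux / of S2 is
`{y ∈ H¹(Γ_{ℚ_∞}, A_g) | unr ∧ arch ∧ (∀ v ∣ 2, ∀ σ, ∃ φ Q k, [φ] = conj_σ y ∧ 2ᵏQ_i ∈ ⨆ₘE⁺ ∧ ∀ τ i, Θ_v(φ τ)_i = τQ_i − Q_i) ∧ ϖy = 0}`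
for a local transport datum `Θ_v : A_g ≃+ (W[2^∞])ⁿ` equivariant for the decomposition group at `v`. S2 quantifies over ALL
such data; a proof of S2 through one preferred datum `Θ⁰` (local universality) therefore needs the set to be `Θ`-independent.
From the integral Schur lemma (`…IntegralSchurAtTwo.transportedKummer_iff_of_decomp_equivariant`):
* `exists_cocycle_transportedKummer_iff` — the local clause WITH the cocycle existential, for any class `c ∈ H¹(H, A)`
  (`c = conj_σ y` in the crux), closed `H ≤ Γ_ℚ`, two data `Θ`, `Θ'` (sizes `n`, `n'`): clause for `Θ` ⇔ clause for `Θ'`;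
* `setOf_transportedKummer_eq_of_decomp_equivariant` — the counted SET, with arbitrary side predicates `P₁ P₂ R` (unramified /
  archimedean / torsion clauses) and local subgroups `L_v`, is the same for two families `Θ_v`, `Θ'_v` (so are its `ncard`,
  `encard`). Instantiate `H = κ.kerSubgroup` (closed: `ZpExtension.isClosed_kerSubgroup`), `L_v = ⨆ₘ signedLocalPoints κ ℚ_v W 1 m`.

References: [SerreInventiones1972] §1.11 Prop. 12, §2.2; [Kobayashi2003] Def. 1.1; [SerreGaloisCohomology1997] I §2.2.
-/

set_option autoImplicit false
-- the Theorems namespace of this sub repeats the summit name by design (D-0017 nested layout)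
set_option linter.dupNamespace false

noncomputable section

open scoped AddSubgroup
open WeierstrassCurve NumberField Field IsDedekindDomain Literature Literature.NumberTheory.EllipticCurves
  Literature.NumberTheory.GaloisRepresentations Literature.NumberTheory.EllipticCurves.Rank1Residual

namespace Summit.BirchSwinnertonDyer.BirchSwinnertonDyer.Theorems.ThetaTransport

variable (W : WeierstrassCurve ℚ) [W.IsElliptic] [W.IsGloballyMinimal]
  {A : Type} [AddCommGroup A] [DistribMulAction (absoluteGaloisGroup ℚ) A] [TopologicalSpace A] [DiscreteTopology A]

/-- **Θ-independence with the cocycle existential** (granted Serre 1972 Prop. 12) — the local clause at `v ∣ 2` of stubs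
`stub_transport` / S2 `stub_cmLambdaLower` VERBATIM in shape, for a class `c ∈ H¹(H, A)` (in the crux `c = conj_σ y`):
`(∃ φ Q k, [φ] = c ∧ (∀ i, 2ᵏQ_i ∈ L) ∧ ∀ τ i, Θ(φ τ)_i = τQ_i − Q_i) ↔ (∃ φ Q' k, [φ] = c ∧ … Θ' …)`, for a closed `H ≤ Γ_ℚ` and two
`D_v`-equivariant data `Θ`, `Θ'`. [cite: SerreInventiones1972, §1.11 Prop. 12; §2.2] [cite: Kobayashi2003, Def. 1.1] -/
theorem exists_cocycle_transportedKummer_iff (hSe : serre1972_supersingular_decompositionSubgroup_image)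
    (hss : GoodSS W 2) (ha2 : W.frobeniusTrace 2 = 0) (v : HeightOneSpectrum (𝓞 ℚ)) (hv : ((2 : ℕ) : 𝓞 ℚ) ∈ v.asIdeal)
    (H : Subgroup (absoluteGaloisGroup ℚ)) (hH : IsClosed (H : Set (absoluteGaloisGroup ℚ)))
    {n n' : ℕ} (Θ : A ≃+ (Fin n → ↥(W.geomPrimaryTorsion 2))) (Θ' : A ≃+ (Fin n' → ↥(W.geomPrimaryTorsion 2)))
    (hΘ : ∀ (δ : absoluteGaloisGroup (v.adicCompletion ℚ)) (m : A) (i : Fin n),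
      Θ (resGalOfEmb (closureEmb (K := ℚ) (v.adicCompletion ℚ)) δ • m) i =
        resGalOfEmb (closureEmb (K := ℚ) (v.adicCompletion ℚ)) δ • Θ m i)
    (hΘ' : ∀ (δ : absoluteGaloisGroup (v.adicCompletion ℚ)) (m : A) (i : Fin n'),
      Θ' (resGalOfEmb (closureEmb (K := ℚ) (v.adicCompletion ℚ)) δ • m) i =
        resGalOfEmb (closureEmb (K := ℚ) (v.adicCompletion ℚ)) δ • Θ' m i)
    (L : AddSubgroup (localPoints W (v.adicCompletion ℚ))) (c : subgroupH1 H A) :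
    (∃ (φ : contOneCocycles (discreteTopRep H A)) (Q : Fin n → localPoints W (v.adicCompletion ℚ)) (k : ℕ),
      oneCocycleClass (discreteTopRep H A) φ = c ∧ (∀ i, (2 ^ k) • Q i ∈ L) ∧
      ∀ (τ : localSubgroupOfEmb H (closureEmb (K := ℚ) (v.adicCompletion ℚ))) (i : Fin n),
        pointsMapOfEmb W (closureEmb (K := ℚ) (v.adicCompletion ℚ))
          ((Θ (φ.1 (resGalSubgroupOfEmb H (closureEmb (K := ℚ) (v.adicCompletion ℚ)) τ)) i : ↥(W.geomPrimaryTorsion 2)) :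
            W.geomPoints) = (τ : absoluteGaloisGroup (v.adicCompletion ℚ)) • Q i - Q i) ↔
    ∃ (φ : contOneCocycles (discreteTopRep H A)) (Q' : Fin n' → localPoints W (v.adicCompletion ℚ)) (k : ℕ),
      oneCocycleClass (discreteTopRep H A) φ = c ∧ (∀ i, (2 ^ k) • Q' i ∈ L) ∧
      ∀ (τ : localSubgroupOfEmb H (closureEmb (K := ℚ) (v.adicCompletion ℚ))) (i : Fin n'),
        pointsMapOfEmb W (closureEmb (K := ℚ) (v.adicCompletion ℚ))
          ((Θ' (φ.1 (resGalSubgroupOfEmb H (closureEmb (K := ℚ) (v.adicCompletion ℚ)) τ)) i : ↥(W.geomPrimaryTorsion 2)) :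
            W.geomPoints) = (τ : absoluteGaloisGroup (v.adicCompletion ℚ)) • Q' i - Q' i := by
  have key := fun φ ↦ transportedKummer_iff_of_decomp_equivariant W hSe hss ha2 v hv H hH Θ Θ' hΘ hΘ' L φ
  constructor
  · rintro ⟨φ, Q, k, hc, hQ, hτ⟩
    obtain ⟨Q', k', hQ', hτ'⟩ := (key φ).1 ⟨Q, k, hQ, hτ⟩
    exact ⟨φ, Q', k', hc, hQ', hτ'⟩
  · rintro ⟨φ, Q', k, hc, hQ', hτ'⟩
    obtain ⟨Q, k', hQ, hτ⟩ := (key φ).2 ⟨Q', k, hQ', hτ'⟩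
    exact ⟨φ, Q, k', hc, hQ, hτ⟩

/-- **Θ-independence of the transported Selmer SET** (granted Serre 1972 Prop. 12) — the `g`-side counted set of the crux
(R≥)ᵖ / stub S2 does not depend on the local transport data: for a closed normal `H ≤ Γ_ℚ` (in the crux `Γ_{ℚ_∞}`), side
predicates `P₁ P₂ R` (unramified / archimedean / `ϖ`-torsion clauses), subgroups `L_v` of local points (`⨆ₘ E⁺(ℚ_{m,v})`), and two
families `Θ_v`, `Θ'_v` (`v ∣ 2`) of `D_v`-equivariant data, the sets
`{y | P₁ y ∧ P₂ y ∧ (∀ v∣2, ∀ σ, ∃ φ Q k, [φ] = conj_σ y ∧ 2ᵏQ ∈ L_v ∧ Θ_v-Kummer identity) ∧ R y}` for `Θ` and for `Θ'` coincide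
(hence have the same `ncard` / `encard`). [cite: SerreInventiones1972, §1.11 Prop. 12; §2.2] [cite: Kobayashi2003, Def. 1.1] -/
theorem setOf_transportedKummer_eq_of_decomp_equivariant (hSe : serre1972_supersingular_decompositionSubgroup_image)
    (hss : GoodSS W 2) (ha2 : W.frobeniusTrace 2 = 0)
    (H : Subgroup (absoluteGaloisGroup ℚ)) [H.Normal] (hH : IsClosed (H : Set (absoluteGaloisGroup ℚ)))
    {n n' : ℕ} (Θ : ∀ v : HeightOneSpectrum (𝓞 ℚ), ((2 : ℕ) : 𝓞 ℚ) ∈ v.asIdeal → (A ≃+ (Fin n → ↥(W.geomPrimaryTorsion 2))))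
    (Θ' : ∀ v : HeightOneSpectrum (𝓞 ℚ), ((2 : ℕ) : 𝓞 ℚ) ∈ v.asIdeal → (A ≃+ (Fin n' → ↥(W.geomPrimaryTorsion 2))))
    (hΘ : ∀ (v : HeightOneSpectrum (𝓞 ℚ)) (hv : ((2 : ℕ) : 𝓞 ℚ) ∈ v.asIdeal) (δ : absoluteGaloisGroup (v.adicCompletion ℚ))
      (m : A) (i : Fin n), Θ v hv (resGalOfEmb (closureEmb (K := ℚ) (v.adicCompletion ℚ)) δ • m) i =
        resGalOfEmb (closureEmb (K := ℚ) (v.adicCompletion ℚ)) δ • Θ v hv m i)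
    (hΘ' : ∀ (v : HeightOneSpectrum (𝓞 ℚ)) (hv : ((2 : ℕ) : 𝓞 ℚ) ∈ v.asIdeal) (δ : absoluteGaloisGroup (v.adicCompletion ℚ))
      (m : A) (i : Fin n'), Θ' v hv (resGalOfEmb (closureEmb (K := ℚ) (v.adicCompletion ℚ)) δ • m) i =
        resGalOfEmb (closureEmb (K := ℚ) (v.adicCompletion ℚ)) δ • Θ' v hv m i)
    (L : ∀ v : HeightOneSpectrum (𝓞 ℚ), AddSubgroup (localPoints W (v.adicCompletion ℚ)))
    (P₁ P₂ R : subgroupH1 H A → Prop) :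
    {y : subgroupH1 H A | P₁ y ∧ P₂ y ∧ (∀ (v : HeightOneSpectrum (𝓞 ℚ)) (hv : ((2 : ℕ) : 𝓞 ℚ) ∈ v.asIdeal)
      (σ : absoluteGaloisGroup ℚ), ∃ (φ : contOneCocycles (discreteTopRep H A))
        (Q : Fin n → localPoints W (v.adicCompletion ℚ)) (k : ℕ),
        oneCocycleClass (discreteTopRep H A) φ = conjH1 H A σ y ∧ (∀ i, (2 ^ k) • Q i ∈ L v) ∧
        ∀ (τ : localSubgroupOfEmb H (closureEmb (K := ℚ) (v.adicCompletion ℚ))) (i : Fin n),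
          pointsMapOfEmb W (closureEmb (K := ℚ) (v.adicCompletion ℚ))
            ((Θ v hv (φ.1 (resGalSubgroupOfEmb H (closureEmb (K := ℚ) (v.adicCompletion ℚ)) τ)) i : ↥(W.geomPrimaryTorsion 2)) :
              W.geomPoints) = (τ : absoluteGaloisGroup (v.adicCompletion ℚ)) • Q i - Q i) ∧ R y} =
    {y : subgroupH1 H A | P₁ y ∧ P₂ y ∧ (∀ (v : HeightOneSpectrum (𝓞 ℚ)) (hv : ((2 : ℕ) : 𝓞 ℚ) ∈ v.asIdeal)
      (σ : absoluteGaloisGroup ℚ), ∃ (φ : contOneCocycles (discreteTopRep H A))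
        (Q' : Fin n' → localPoints W (v.adicCompletion ℚ)) (k : ℕ),
        oneCocycleClass (discreteTopRep H A) φ = conjH1 H A σ y ∧ (∀ i, (2 ^ k) • Q' i ∈ L v) ∧
        ∀ (τ : localSubgroupOfEmb H (closureEmb (K := ℚ) (v.adicCompletion ℚ))) (i : Fin n'),
          pointsMapOfEmb W (closureEmb (K := ℚ) (v.adicCompletion ℚ))
            ((Θ' v hv (φ.1 (resGalSubgroupOfEmb H (closureEmb (K := ℚ) (v.adicCompletion ℚ)) τ)) i : ↥(W.geomPrimaryTorsion 2)) :
              W.geomPoints) = (τ : absoluteGaloisGroup (v.adicCompletion ℚ)) • Q' i - Q' i) ∧ R y} := by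
  ext y
  refine and_congr_right fun _ ↦ and_congr_right fun _ ↦ and_congr_left fun _ ↦
    forall_congr' fun v ↦ forall_congr' fun hv ↦ forall_congr' fun σ ↦ ?_
  exact exists_cocycle_transportedKummer_iff W hSe hss ha2 v hv H hH (Θ v hv) (Θ' v hv) (hΘ v hv) (hΘ' v hv) (L v) _

end Summit.BirchSwinnertonDyer.BirchSwinnertonDyer.Theorems.ThetaTransport

end
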